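/-
Origin: expansion seat `planner-pub-hodgecm-toy-g2-0`, handover #14 2026-08-18T07:57:03Z (`HOME/pub-hodgecm-toy-g2/lean/ToyG2/EigenForms.lean`, md5 bf4fd228, 440 lines);
landed by the gen-7 packager in gate run 26 as `HodgeCM/Model/ToyG2/EigenForms.lean` (import ^import ToyG2\.→import HodgeCM.Model.ToyG2. ×1).
-/
/-
# HodgeCM.Model.ToyG2.EigenForms — rational forms of a block on eigenvector monomials

Generation 2 of the `pub-hodgecm-toy` lineage (seat `planner-pub-hodgecm-toy-g2-0`), file E of the
programme in `pub-hodgecm-toy-g2/DESIGN.md` §8.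

For a gen-1 object `X : Obj` and a rational functional `φ : ⋀^k X.L → ℚ` we form its complexification
`baseC X φ : ⋀^k_ℂ (ℂ ⊗ X.L) → ℂ` (through the base-change isomorphism `X.Θ k`) and the associated
alternating form `baseCA X φ` on `ℂ ⊗ X.L`.  The expansion lemma `baseCA_expand` evaluates it on vectors
`∑ m, c j m • (1 ⊗ v j m)` with a UNIFORM index type (this avoids the dependent pi-sums of
`Obj.theta_symm_mono`).  For the block object `PP L Θ` and the functional `ellLin L Θ ξ d t` of
`Blocks.lean` this gives the value of `ℓ_ℂ` on eigenvector monomials in the slot pattern `a a b b`: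

  `ℓ_ℂ (e_{a,τ₀}, e_{a,τ₁}, e_{b,τ₂}, e_{b,τ₃}) = ellCoef d a b · E^ℂ_a (τ₀, τ₁) · E^ℂ_b (τ₂, τ₃)`,
  `E^ℂ_i (τ, τ') = 2 τ(ξ_i) · [τ' = conj ∘ τ]`                                   (`E2C_eq`),

using the duality `∑ m, τ (d m) ρ (b m) = [ρ = τ]` of the trace-dual bases (`sum_emb_dF_mul_emb_bF`).
These are the entries of the period matrix of the gen-2 Shimura leaf (realisation leg) and the input for
the Hodge type `(2,2)` of `ℓ` (Gysin leg).
-/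
import Mathlib
import Summits.HodgeConjecture.HodgeCM.Model.ToyG2.Blocks_2

open scoped TensorProduct ComplexConjugate
open HodgeCM.Toy HodgeCM.Toy.CMPresentation exteriorPower NumberField.ComplexEmbedding
open Literature.AlgebraicGeometry.Motives
open Literature.AlgebraicGeometry.ShimuraVarieties (conjRingHomK)

namespace HodgeCM.ToyG2

noncomputable section

/-! ## §1 Complexified forms on a gen-1 object -/
section Generic

variable (X : Obj) {k : ℕ}

/-- the `ℂ`-linear extension of a rational functional on `⋀^k X.L`, as a functional on `⋀^k_ℂ (ℂ ⊗ X.L)` -/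
def baseC (φ : (⋀[ℚ]^k X.L) →ₗ[ℚ] ℚ) : (⋀[ℂ]^k X.LC) →ₗ[ℂ] ℂ :=
  (TensorProduct.AlgebraTensorModule.rid ℚ ℂ ℂ).toLinearMap ∘ₗ (φ.baseChange ℂ) ∘ₗ
    (X.Θ k).symm.toLinearMap

/-- the same as an alternating `k`-form on `ℂ ⊗ X.L` -/
def baseCA (φ : (⋀[ℚ]^k X.L) →ₗ[ℚ] ℚ) : X.LC [⋀^Fin k]→ₗ[ℂ] ℂ :=
  (baseC X φ).compAlternatingMap (ιMulti ℂ k)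

/-- (Ported verbatim from the HodgeCMPerL package; no docstring in the source.) -/
@[simp] theorem baseCA_apply (φ : (⋀[ℚ]^k X.L) →ₗ[ℚ] ℚ) (w : Fin k → X.LC) :
    baseCA X φ w = baseC X φ (ιMulti ℂ k w) := rfl

/-- (Ported verbatim from the HodgeCMPerL package; no docstring in the source.) -/
theorem baseC_mono (φ : (⋀[ℚ]^k X.L) →ₗ[ℚ] ℚ) (g : Fin k → X.Idx) :
    baseC X φ (X.mono k g) = baseCA X φ (fun j => X.eB (g j)) := rfl

/-- (Ported verbatim from the HodgeCMPerL package; no docstring in the source.) -/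
theorem theta_symm_ιMulti_tmul (v : Fin k → X.L) :
    (X.Θ k).symm (ιMulti ℂ k (fun i => (1 : ℂ) ⊗ₜ[ℚ] v i)) = (1 : ℂ) ⊗ₜ[ℚ] ιMulti ℚ k v := by
  rw [LinearEquiv.symm_apply_eq]
  simp only [BC.thetaEquiv_apply, BC.theta_tmul_ιMulti, one_smul]

/-- on rational pure wedges the complexified form is the original one -/
theorem baseCA_tmul (φ : (⋀[ℚ]^k X.L) →ₗ[ℚ] ℚ) (v : Fin k → X.L) :
    baseCA X φ (fun i => (1 : ℂ) ⊗ₜ[ℚ] v i) = (φ (ιMulti ℚ k v) : ℂ) := by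
  simp only [baseCA_apply, baseC, LinearMap.coe_comp, Function.comp_apply, LinearEquiv.coe_coe,
    theta_symm_ιMulti_tmul, LinearMap.baseChange_tmul, TensorProduct.AlgebraTensorModule.rid_tmul,
    Rat.smul_one_eq_cast]

/-- multilinear expansion with a uniform index type -/
theorem baseCA_expand (φ : (⋀[ℚ]^k X.L) →ₗ[ℚ] ℚ) {ι : Type*} [Fintype ι]
    (c : Fin k → ι → ℂ) (v : Fin k → ι → X.L) :
    baseCA X φ (fun j => ∑ m, c j m • ((1 : ℂ) ⊗ₜ[ℚ] v j m))
      = ∑ M : Fin k → ι, (∏ j, c j (M j)) * (φ (ιMulti ℚ k fun j => v j (M j)) : ℂ) := by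
  classical
  have hsum := MultilinearMap.map_sum (baseCA X φ).toMultilinearMap
    (fun j m => c j m • ((1 : ℂ) ⊗ₜ[ℚ] v j m))
  simp only [AlternatingMap.coe_multilinearMap] at hsum
  rw [hsum]
  refine Finset.sum_congr rfl fun M _ => ?_
  rw [AlternatingMap.map_smul_univ, baseCA_tmul, smul_eq_mul]

end Generic

/-! ## §2 Duality of the trace-dual bases under complex embeddings -/
section Field

variable (F : Type*) [Field F] [NumberField F]

/-- (Ported verbatim from the HodgeCMPerL package; no docstring in the source.) -/
theorem evalC_eps_of_ne {ρ σ : F →+* ℂ} (h : ρ ≠ σ) : evalC ρ (eps F σ) = 0 := by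
  obtain ⟨x, hx⟩ := exists_apply_ne_of_ne h
  have h1 := congrArg (evalC ρ) (tmul_mul_eps σ x)
  rw [map_mul, map_smul, evalC_tmul, one_mul, smul_eq_mul] at h1
  have h2 : (ρ x - σ x) * evalC ρ (eps F σ) = 0 := by rw [sub_mul, h1, sub_self]
  rcases mul_eq_zero.mp h2 with h3 | h3
  · exact absurd (sub_eq_zero.mp h3) hx
  · exact h3

/-- (Ported verbatim from the HodgeCMPerL package; no docstring in the source.) -/
theorem evalC_eps_self (σ : F →+* ℂ) : evalC σ (eps F σ) = 1 := by
  classical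
  have h := congrArg (evalC σ) (sum_eps (F := F))
  rw [map_sum, map_one, Finset.sum_eq_single σ] at h
  · exact h
  · intro ρ _ hρ
    exact evalC_eps_of_ne F (Ne.symm hρ)
  · intro hσ
    exact absurd (Finset.mem_univ σ) hσ

open scoped Classical in
/-- duality of the trace-dual bases under two embeddings: `∑ m, τ (d m) ρ (b m) = [ρ = τ]` -/
theorem sum_emb_dF_mul_emb_bF (τ ρ : F →+* ℂ) :
    ∑ m, τ (dF F m) * ρ (bF F m) = if ρ = τ then 1 else 0 := by
  classical
  have h : evalC ρ (eps F τ) = ∑ m, τ (dF F m) * ρ (bF F m) := by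
    simp [eps, map_sum, evalC_tmul]
  rw [← h]
  split_ifs with hρ
  · subst hρ
    exact evalC_eps_self F ρ
  · exact evalC_eps_of_ne F hρ

open scoped Classical in
/-- the conjugate variant -/
theorem sum_emb_dF_mul_conj_emb_bF (τ ρ : F →+* ℂ) :
    ∑ m, τ (dF F m) * conj (ρ (bF F m)) = if conjugate ρ = τ then 1 else 0 := by
  have h := sum_emb_dF_mul_emb_bF F τ (conjugate ρ)
  simpa only [conjugate_coe_eq] using h

end Field

/-! ## §3 The block functional on eigenvector monomials -/
section Block

variable (L : CMField) (Θ : Fin 4 → CMType L) (ξ : Fin 4 → L) (d t : ℚ)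

/-- the eigen-index of `PP L Θ` in slot `a` with character `τ` -/
def ix (τ : FK L →+* ℂ) : Fin 4 → (PP L Θ).Idx
  | 0 => ⟨Sum.inl (Sum.inl (Sum.inl ())), τ⟩
  | 1 => ⟨Sum.inl (Sum.inl (Sum.inr ())), τ⟩
  | 2 => ⟨Sum.inl (Sum.inr ()), τ⟩
  | 3 => ⟨Sum.inr (), τ⟩

/-- (Ported verbatim from the HodgeCMPerL package; no docstring in the source.) -/
theorem ix_fst (τ : FK L →+* ℂ) (a : Fin 4) : (ix L Θ τ a).1 = slot L Θ a := by
  fin_cases a <;> rfl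

/-- (Ported verbatim from the HodgeCMPerL package; no docstring in the source.) -/
theorem ix_injective (τ : Fin 4 → (FK L →+* ℂ)) : Function.Injective (fun j => ix L Θ (τ j) j) := by
  intro i j h
  have h1 : (ix L Θ (τ i) i).1 = (ix L Θ (τ j) j).1 := congrArg Sigma.fst h
  rw [ix_fst, ix_fst] at h1
  exact slot_injective L Θ h1

/-- expansion of an eigenvector in slot `a` along the rational basis `b` of `F_L`, uniformly in `a` -/
theorem eB_ix (τ : FK L →+* ℂ) (a : Fin 4) :
    (PP L Θ).eB (ix L Θ τ a)
      = ∑ m : Fin (Module.finrank ℚ (FK L)), (τ (dF (FK L) m)) • ((1 : ℂ) ⊗ₜ[ℚ] emb L Θ a (bF (FK L) m)) := by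
  fin_cases a <;> exact (PP L Θ).eB_expand _

/-- the complexified pair form `E^ℂ_i (τ, τ') = ∑ τ(d m) τ'(d m') E_i (b m, b m')` -/
def E2C (i : Fin 4) (τ τ' : FK L →+* ℂ) : ℂ :=
  ∑ m : Fin (Module.finrank ℚ (FK L)), ∑ m' : Fin (Module.finrank ℚ (FK L)),
    τ (dF (FK L) m) * τ' (dF (FK L) m') * (E2 L ξ i ![bF (FK L) m, bF (FK L) m'] : ℂ)

/-- (Ported verbatim from the HodgeCMPerL package; no docstring in the source.) -/
theorem v4_0 {α : Type*} (x₀ x₁ x₂ x₃ : α) : ![x₀, x₁, x₂, x₃] 0 = x₀ := rfl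
/-- (Ported verbatim from the HodgeCMPerL package; no docstring in the source.) -/
theorem v4_1 {α : Type*} (x₀ x₁ x₂ x₃ : α) : ![x₀, x₁, x₂, x₃] 1 = x₁ := rfl
/-- (Ported verbatim from the HodgeCMPerL package; no docstring in the source.) -/
theorem v4_2 {α : Type*} (x₀ x₁ x₂ x₃ : α) : ![x₀, x₁, x₂, x₃] 2 = x₂ := rfl
/-- (Ported verbatim from the HodgeCMPerL package; no docstring in the source.) -/
theorem v4_3 {α : Type*} (x₀ x₁ x₂ x₃ : α) : ![x₀, x₁, x₂, x₃] 3 = x₃ := rfl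

/-- a sum over `Fin 4 → ι` as an iterated sum -/
theorem sum_arrow_fin4 {R : Type*} [AddCommMonoid R] {ι : Type*} [Fintype ι] (G : (Fin 4 → ι) → R) :
    ∑ M, G M = ∑ m₀, ∑ m₁, ∑ m₂, ∑ m₃, G ![m₀, m₁, m₂, m₃] := by
  let e : (Fin 4 → ι) ≃ ι × ι × ι × ι :=
    { toFun := fun M => (M 0, M 1, M 2, M 3)
      invFun := fun p => ![p.1, p.2.1, p.2.2.1, p.2.2.2]
      left_inv := fun M => by funext j; fin_cases j <;> rfl
      right_inv := fun p => rfl }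
  rw [Fintype.sum_equiv e G (fun p => G ![p.1, p.2.1, p.2.2.1, p.2.2.2])
    (fun M => (congrArg G (e.left_inv M)).symm)]
  simp only [Fintype.sum_prod_type]

/-- MAIN VALUE (pattern `a a b b`, `a < b`): only the `Eₐ ∧ E_b` term of `ℓ` survives, and it factors. -/
theorem baseCA_ell_pair {a b : Fin 4} (hab : a < b) (τ : Fin 4 → (FK L →+* ℂ)) :
    baseCA (PP L Θ) (ellLin L Θ ξ d t) (fun j => (PP L Θ).eB (ix L Θ (τ j) (![a, a, b, b] j)))
      = (ellCoef d a b : ℂ) * (E2C L ξ a (τ 0) (τ 1) * E2C L ξ b (τ 2) (τ 3)) := by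
  classical
  have hfam : ∀ M : Fin 4 → Fin (Module.finrank ℚ (FK L)),
      (fun j => emb L Θ (![a, a, b, b] j) (bF (FK L) (M j)))
        = ![emb L Θ a (bF (FK L) (M 0)), emb L Θ a (bF (FK L) (M 1)),
            emb L Θ b (bF (FK L) (M 2)), emb L Θ b (bF (FK L) (M 3))] := by
    intro M
    funext j
    fin_cases j <;> rfl
  have hterm : ∀ M : Fin 4 → Fin (Module.finrank ℚ (FK L)),
      ((ellLin L Θ ξ d t (ιMulti ℚ 4 fun j => emb L Θ (![a, a, b, b] j) (bF (FK L) (M j))) : ℚ) : ℂ)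
        = (ellCoef d a b : ℂ) * ((E2 L ξ a ![bF (FK L) (M 0), bF (FK L) (M 1)] : ℂ)
            * (E2 L ξ b ![bF (FK L) (M 2), bF (FK L) (M 3)] : ℂ)) := by
    intro M
    rw [hfam M, ellLin_apply_ιMulti, ell_apply_pair L Θ ξ d t hab]
    simp only [Rat.cast_mul]
  simp_rw [eB_ix]
  rw [baseCA_expand]
  simp_rw [hterm, Fin.prod_univ_four]
  rw [sum_arrow_fin4]
  simp only [v4_0, v4_1, v4_2, v4_3]
  unfold E2C
  simp_rw [Finset.sum_mul, Finset.mul_sum]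
  refine Finset.sum_congr rfl fun m₀ _ => Finset.sum_congr rfl fun m₁ _ =>
    Finset.sum_congr rfl fun m₂ _ => Finset.sum_congr rfl fun m₃ _ => ?_
  ring

open scoped Classical in
variable {ξ} in
/-- the complexified pair form evaluated: `E^ℂ_i (τ, τ') = 2 τ(ξ_i) [τ' = conj ∘ τ]` -/
theorem E2C_eq (hξ : ∀ i, conjRingHomK L (ξ i) = -ξ i) (i : Fin 4) (τ τ' : FK L →+* ℂ) :
    E2C L ξ i τ τ' = if τ' = conjugate τ then 2 * τ (eK L (ξ i)) else 0 := by
  classical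
  have hE : ∀ m m' : Fin (Module.finrank ℚ (FK L)),
      ((E2 L ξ i ![bF (FK L) m, bF (FK L) m'] : ℚ) : ℂ)
        = ∑ ρ : FK L →+* ℂ, 2 * (ρ (eK L (ξ i)) * ρ (bF (FK L) m) * conj (ρ (bF (FK L) m'))) := by
    intro m m'
    rw [E2_antisymm_apply L hξ, Rat.cast_mul, Rat.cast_ofNat, trace_eq_sum_ringHom, Finset.mul_sum]
    simp only [Matrix.cons_val_zero, Matrix.cons_val_one, map_mul, emb_cF]
  have hd1 : ∀ ρ : FK L →+* ℂ,
      ∑ m, τ (dF (FK L) m) * ρ (bF (FK L) m) = if ρ = τ then 1 else 0 :=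
    fun ρ => sum_emb_dF_mul_emb_bF (FK L) τ ρ
  have hd2 : ∀ ρ : FK L →+* ℂ,
      ∑ m', τ' (dF (FK L) m') * conj (ρ (bF (FK L) m')) = if conjugate ρ = τ' then 1 else 0 :=
    fun ρ => sum_emb_dF_mul_conj_emb_bF (FK L) τ' ρ
  unfold E2C
  simp_rw [hE]
  calc ∑ m, ∑ m', τ (dF (FK L) m) * τ' (dF (FK L) m')
          * ∑ ρ : FK L →+* ℂ, 2 * (ρ (eK L (ξ i)) * ρ (bF (FK L) m) * conj (ρ (bF (FK L) m')))
      = ∑ ρ : FK L →+* ℂ, ∑ m, ∑ m', τ (dF (FK L) m) * τ' (dF (FK L) m')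
          * (2 * (ρ (eK L (ξ i)) * ρ (bF (FK L) m) * conj (ρ (bF (FK L) m')))) := by
        simp_rw [Finset.mul_sum]
        exact (Finset.sum_congr rfl fun m _ => Finset.sum_comm).trans Finset.sum_comm
    _ = ∑ ρ : FK L →+* ℂ, 2 * ρ (eK L (ξ i)) * ((∑ m, τ (dF (FK L) m) * ρ (bF (FK L) m))
          * (∑ m', τ' (dF (FK L) m') * conj (ρ (bF (FK L) m')))) := by
        refine Finset.sum_congr rfl fun ρ _ => ?_
        rw [Finset.sum_mul_sum, Finset.mul_sum]
        refine Finset.sum_congr rfl fun m _ => ?_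
        rw [Finset.mul_sum]
        refine Finset.sum_congr rfl fun m' _ => ?_
        ring
    _ = if τ' = conjugate τ then 2 * τ (eK L (ξ i)) else 0 := by
        simp_rw [hd1, hd2]
        rw [Finset.sum_eq_single τ]
        · by_cases h : τ' = conjugate τ
          · rw [if_pos h, if_pos rfl, if_pos h.symm]
            ring
          · rw [if_neg h, if_pos rfl, if_neg (fun h' => h h'.symm)]
            ring
        · intro ρ _ hρ
          rw [if_neg hρ]
          ring
        · intro h
          exact absurd (Finset.mem_univ τ) h

open scoped Classical in
variable {ξ} in
/-- MAIN VALUE, evaluated: for a Riemann system (`ξ̄ᵢ = -ξᵢ`),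
`ℓ_ℂ (e_{a,τ₀}, e_{a,τ₁}, e_{b,τ₂}, e_{b,τ₃}) = ellCoef d a b · (2τ₀(ξₐ)[τ₁ = τ̄₀]) · (2τ₂(ξ_b)[τ₃ = τ̄₂])`. -/
theorem baseCA_ell_pair_eq (hξ : ∀ i, conjRingHomK L (ξ i) = -ξ i) {a b : Fin 4} (hab : a < b)
    (τ : Fin 4 → (FK L →+* ℂ)) :
    baseCA (PP L Θ) (ellLin L Θ ξ d t) (fun j => (PP L Θ).eB (ix L Θ (τ j) (![a, a, b, b] j)))
      = (ellCoef d a b : ℂ)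
        * ((if τ 1 = conjugate (τ 0) then 2 * τ 0 (eK L (ξ a)) else 0)
          * (if τ 3 = conjugate (τ 2) then 2 * τ 2 (eK L (ξ b)) else 0)) := by
  rw [baseCA_ell_pair L Θ ξ d t hab, E2C_eq L hξ, E2C_eq L hξ]

open scoped Classical in
variable {ξ} in
/-- the same for the monomial `mono` of the eigenbasis -/
theorem baseC_ell_mono_pair_eq (hξ : ∀ i, conjRingHomK L (ξ i) = -ξ i) {a b : Fin 4} (hab : a < b)
    (τ : Fin 4 → (FK L →+* ℂ)) :
    baseC (PP L Θ) (ellLin L Θ ξ d t) ((PP L Θ).mono 4 (fun j => ix L Θ (τ j) (![a, a, b, b] j)))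
      = (ellCoef d a b : ℂ)
        * ((if τ 1 = conjugate (τ 0) then 2 * τ 0 (eK L (ξ a)) else 0)
          * (if τ 3 = conjugate (τ 2) then 2 * τ 2 (eK L (ξ b)) else 0)) := by
  rw [baseC_mono]
  exact baseCA_ell_pair_eq L Θ d t hξ hab τ

/-- three indicator factors -/
theorem mul_ite_one_zero_three {p q r : Prop} [Decidable p] [Decidable q] [Decidable r] (x : ℂ) :
    x * ((if p then 1 else 0) * (if q then 1 else 0) * (if r then 1 else 0))
      = if p ∧ q ∧ r then x else 0 := by
  split_ifs <;> simp_all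

open scoped Classical in
/-- MAIN VALUE (pattern `0 1 2 3`): only the twist survives,
`ℓ_ℂ (e_{0,τ₀}, e_{1,τ₁}, e_{2,τ₂}, e_{3,τ₃}) = t · τ₀(ξ₂ξ₃) · [τ₀ = τ₁ ∧ τ̄₀ = τ₂ ∧ τ̄₀ = τ₃]`. -/
theorem baseCA_ell_sorted (τ : Fin 4 → (FK L →+* ℂ)) :
    baseCA (PP L Θ) (ellLin L Θ ξ d t) (fun j => (PP L Θ).eB (ix L Θ (τ j) j))
      = (t : ℂ) * (if τ 0 = τ 1 ∧ conjugate (τ 0) = τ 2 ∧ conjugate (τ 0) = τ 3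
          then τ 0 (eK L (ξ 2 * ξ 3)) else 0) := by
  classical
  have hterm : ∀ M : Fin 4 → Fin (Module.finrank ℚ (FK L)),
      ((ellLin L Θ ξ d t (ιMulti ℚ 4 fun j => emb L Θ j (bF (FK L) (M j))) : ℚ) : ℂ)
        = (t : ℂ) * ∑ ρ : FK L →+* ℂ, ρ (eK L (ξ 2 * ξ 3))
            * (ρ (bF (FK L) (M 0)) * ρ (bF (FK L) (M 1)) * conj (ρ (bF (FK L) (M 2)))
              * conj (ρ (bF (FK L) (M 3)))) := by
    intro M
    rw [ellLin_apply_ιMulti, ell_apply_sorted L Θ ξ d t (fun k => bF (FK L) (M k)), Rat.cast_mul,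
      trace_eq_sum_ringHom]
    congr 1
    refine Finset.sum_congr rfl fun ρ _ => ?_
    simp only [map_mul, emb_cF]
    ring
  have hfac : ∀ ρ : FK L →+* ℂ,
      ∑ M : Fin 4 → Fin (Module.finrank ℚ (FK L)), (∏ j, τ j (dF (FK L) (M j)))
          * (ρ (bF (FK L) (M 0)) * ρ (bF (FK L) (M 1)) * conj (ρ (bF (FK L) (M 2)))
            * conj (ρ (bF (FK L) (M 3))))
        = ∏ j : Fin 4, ∑ m : Fin (Module.finrank ℚ (FK L)), τ j (dF (FK L) m)
            * (![(ρ : FK L → ℂ), (ρ : FK L → ℂ), fun y => conj (ρ y), fun y => conj (ρ y)] j)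
                (bF (FK L) m) := by
    intro ρ
    rw [Fintype.prod_sum]
    refine Finset.sum_congr rfl fun M _ => ?_
    rw [Finset.prod_mul_distrib]
    congr 1
    simp only [Fin.prod_univ_four, v4_0, v4_1, v4_2, v4_3]
  simp_rw [eB_ix]
  rw [baseCA_expand]
  simp_rw [hterm]
  calc ∑ M : Fin 4 → Fin (Module.finrank ℚ (FK L)), (∏ j, τ j (dF (FK L) (M j)))
          * ((t : ℂ) * ∑ ρ : FK L →+* ℂ, ρ (eK L (ξ 2 * ξ 3))
            * (ρ (bF (FK L) (M 0)) * ρ (bF (FK L) (M 1)) * conj (ρ (bF (FK L) (M 2)))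
              * conj (ρ (bF (FK L) (M 3)))))
      = (t : ℂ) * ∑ ρ : FK L →+* ℂ, ρ (eK L (ξ 2 * ξ 3))
          * ∑ M : Fin 4 → Fin (Module.finrank ℚ (FK L)), (∏ j, τ j (dF (FK L) (M j)))
            * (ρ (bF (FK L) (M 0)) * ρ (bF (FK L) (M 1)) * conj (ρ (bF (FK L) (M 2)))
              * conj (ρ (bF (FK L) (M 3)))) := by
        simp_rw [Finset.mul_sum]
        rw [Finset.sum_comm]
        exact Finset.sum_congr rfl fun ρ _ => Finset.sum_congr rfl fun M _ => by ring
    _ = (t : ℂ) * ∑ ρ : FK L →+* ℂ, ρ (eK L (ξ 2 * ξ 3))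
          * ((if ρ = τ 0 then 1 else 0) * (if ρ = τ 1 then 1 else 0)
            * (if conjugate ρ = τ 2 then 1 else 0) * (if conjugate ρ = τ 3 then 1 else 0)) := by
        simp_rw [hfac]
        congr 1
        refine Finset.sum_congr rfl fun ρ _ => ?_
        congr 1
        simp only [Fin.prod_univ_four, v4_0, v4_1, v4_2, v4_3, sum_emb_dF_mul_emb_bF,
          sum_emb_dF_mul_conj_emb_bF]
    _ = (t : ℂ) * (if τ 0 = τ 1 ∧ conjugate (τ 0) = τ 2 ∧ conjugate (τ 0) = τ 3
          then τ 0 (eK L (ξ 2 * ξ 3)) else 0) := by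
        congr 1
        rw [Finset.sum_eq_single (τ 0)]
        · rw [if_pos rfl, one_mul]
          exact mul_ite_one_zero_three _
        · intro ρ _ hρ
          simp [if_neg hρ]
        · intro h
          exact absurd (Finset.mem_univ _) h

open scoped Classical in
/-- the same for the monomial `mono` of the eigenbasis -/
theorem baseC_ell_mono_sorted (τ : Fin 4 → (FK L →+* ℂ)) :
    baseC (PP L Θ) (ellLin L Θ ξ d t) ((PP L Θ).mono 4 (fun j => ix L Θ (τ j) j))
      = (t : ℂ) * (if τ 0 = τ 1 ∧ conjugate (τ 0) = τ 2 ∧ conjugate (τ 0) = τ 3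
          then τ 0 (eK L (ξ 2 * ξ 3)) else 0) := by
  rw [baseC_mono]
  exact baseCA_ell_sorted L Θ ξ d t τ

/-- every eigen-index is a slot/character pair -/
theorem ix_surjective (i : (PP L Θ).Idx) : ∃ (a : Fin 4) (τ : FK L →+* ℂ), i = ix L Θ τ a := by
  obtain ⟨(((_ | _) | _) | _), τ⟩ := i
  · exact ⟨0, τ, rfl⟩
  · exact ⟨1, τ, rfl⟩
  · exact ⟨2, τ, rfl⟩
  · exact ⟨3, τ, rfl⟩

/-- (Ported verbatim from the HodgeCMPerL package; no docstring in the source.) -/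
theorem exists_ix_eq (g : Fin 4 → (PP L Θ).Idx) :
    ∃ (s : Fin 4 → Fin 4) (τ : Fin 4 → (FK L →+* ℂ)), g = fun j => ix L Θ (τ j) (s j) := by
  choose s τ h using fun j => ix_surjective L Θ (g j)
  exact ⟨s, τ, funext h⟩

/-- holomorphy of an eigen-index in slot `a`: the character restricted to `L` lies in `Θ a` -/
theorem hol_ix (τ : FK L →+* ℂ) (a : Fin 4) :
    (PP L Θ).hol (ix L Θ τ a) ↔ τ.comp (eK L : L →+* FK L) ∈ (Θ a).1 := by
  fin_cases a <;> exact Iff.rfl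


-- port_pkg: scope closed for this part
end Block
end
end HodgeCM.ToyG2
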